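import Summits.ABC.IUTFork.Cor312PinnedIndTrivialUnitLaw
import Summits.ABC.IUTFork.Cor312PinnedIndTrivialPermLaw
import HarnessLib

/-!
# [IUTchIII] Cor. 3.12 — what the hull `ⁿ˒°𝒰` and the residual `S` READ over the unit and the split shells (orbit forms)

Proof-only junction file (D-0012; NO definition, NO `Prop` fact) of the abc-iut cell (WAVE-5 prover abc-iut-w5-d068, gen 5): the UNIT LAW
(`Cor312PinnedIndTrivialUnitLaw`: possible images over abc-iut-w4-d101's unit shells = the unit orbit of `A = thetaRegion3`) and the PERMUTATION LAW
(`Cor312PinnedIndTrivialPermLaw`: possible images over abc-iut-w5-d230's split shells = the permutation orbit) pushed through the nouns of the (xi-f) edge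
of the frozen Corollary, for EVERY setting over the shell signature in question (no (Ind)-triviality hypothesis; compare the parent
`Cor312PinnedIndTrivial` §1, which needs it). Sequel for the sign shells (pair `{A, −A}`): `Cor312PinnedIndTrivialSignReadings`; scalar shells:
`Cor312PinnedIndTrivialScalarOrbit` (`residual_iff_scalarShells_balls`). TAKES NO SIDE on [IUTchIII] Cor. 3.12 or on any author; toy carriers;
instantiated ≠ endorsed.

* §2 UNIT shells: `sUnion_possibleImages_unitShells` (⋃ = `⋃_{v_p(c)=0} c·A`), `thetaHull_unitShells` (ⁿ˒°𝒰 = frame-hull of the unit orbit),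
  **`residual_iff_unitShells`**: under Thm. 3.11 (ii)(b) for the column and the two region pins, abc-iut-w5-d230's residual `S = PilotKummerIndRelated`
  READS «at every packet the q-pilot region is a `p`-adic-unit homothet `c·A` of the Θ-region» (`reading3_iff_pilotKummerIndRelated` + the unit-orbit
  law) — COSET / K: never (abc-iut-w4-d101 `kSetting_qRegion_not_mem_possibleImages`); U: `S` reads the bare identification of balls and fails.
* §3 SPLIT shells: **`residual_iff_splitShells`**: `S` READS «the q-pilot region is a capsule-permute `permute σ '' A` of the Θ-region» — P♮₁: `σ = swapLast`
  (abc-iut-w5-d230 `splitSetting_pilotKummerIndRelated`); P♮ₑ: no `σ` carries the Θ-box onto the shallower q-box (abc-iut-rp-h3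
  `excSetting_not_pilotKummerIndRelated`); the hull form `thetaHull_splitShells` is in `Cor312PinnedIndTrivialPermLaw`.
So on these shell signatures the residual of the letter is a finite-orbit (split) resp. unit-orbit membership statement about the two honest
Kummer-image regions. Consumed BY NAME (`Setting.thetaHull`, `PilotKummerIndRelated` via `reading3_iff_pilotKummerIndRelated`, nothing restated);
standard axioms; typed ≠ proved. [claim: Mochizuki2012, status: disputed] [cite: ScholzeStix2018, §2.2 pp. 9–10] [cite: DupuyHilado2020, §4.7]
-/

noncomputable section

open Set

namespace Summit.ABC.IUTFork.Cor312Vol.IndTrivial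

open Thm311 Cor312 Cor312.IdentifiedNonVacuity Cor312Vol NaiveWitness NaturalWitness SplitWitness Literature.IUT.LogThetaLattice

/-! ## 2. Unit shells: everything reads the unit orbit -/

section UnitShells

variable (p : ℕ) [hp : Fact p.Prime] (D : ℤ → MRData (UnitWitness.unitShells p))
  (G : ∀ (n : ℤ) (j : Checks.toyIndex.LabelStar), GlobalDegrees (UnitWitness.unitShells p) j)
  (P : Cor312.Setting (⟨UnitWitness.unitShells p, D, G⟩ : Situation Checks.toyIndex))

/-- The union of the possible images over the unit shells is the unit orbit `⋃_{v_p(c) = 0} c·A`. [folklore] -/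
theorem sUnion_possibleImages_unitShells (j : Checks.toyIndex.Label) (vQ : Checks.toyIndex.VQ) :
    ⋃₀ P.possibleImages j vQ = ⋃ c : {c : ℚ // UnitWitness.IsPUnit p c}, (fun x => (c : ℚ) • x) '' P.thetaRegion3 j vQ := by
  rw [possibleImages_eq_unitOrbit p D G P j vQ]
  ext x
  simp only [Set.mem_sUnion, Set.mem_setOf_eq, Set.mem_iUnion]
  constructor
  · rintro ⟨U, ⟨c, hc, rfl⟩, hx⟩
    exact ⟨⟨c, hc⟩, hx⟩
  · rintro ⟨⟨c, hc⟩, hx⟩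
    exact ⟨_, ⟨c, hc, rfl⟩, hx⟩

/-- **The holomorphic hull over the unit shells is the frame-hull of the UNIT ORBIT of the Θ-region** (abc-iut-w4-d101's COSET/K `inflation` theorems
are the instances where the orbit of the pair fills `q^{j²}𝒪^×`). [claim: Mochizuki2012, status: disputed] -/
theorem thetaHull_unitShells (j : Checks.toyIndex.Label) (vQ : Checks.toyIndex.VQ) :
    P.thetaHull j vQ = (P.frame j vQ).hull (⋃ c : {c : ℚ // UnitWitness.IsPUnit p c}, (fun x => (c : ℚ) • x) '' P.thetaRegion3 j vQ) := by
  unfold Setting.thetaHull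
  rw [sUnion_possibleImages_unitShells p D G P j vQ]

/-- **THE RESIDUAL OVER THE UNIT SHELLS READS THE UNIT ORBIT.** Under Thm. 3.11 (ii) (b) for the column and the two region pins, `S` holds iff at every
packet the q-pilot region is `c·A` for some `p`-adic unit `c` (COSET/K: the q-ball is never a unit homothet of the pair — abc-iut-w4-d101's
`kSetting_qRegion_not_mem_possibleImages`; U: balls, `S` reads the bare identification and fails). [claim: Mochizuki2012, status: disputed] -/
theorem residual_iff_unitShells (col : ℤ → Column (UnitWitness.unitShells p))
    (ρ : (∀ v : Checks.toyIndex.V, v ∈ Checks.toyIndex.Vbad → Set ((UnitWitness.unitShells p).StarPacket v)) →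
      ∀ (j : Checks.toyIndex.Label) (vQ : Checks.toyIndex.VQ), Set ((UnitWitness.unitShells p).Packet j vQ))
    (qK : ∀ v : Checks.toyIndex.V, v ∈ Checks.toyIndex.Vbad → Set ((UnitWitness.unitShells p).StarPacket v))
    (hKumB : (col P.n).KummerB (D P.n))
    (hpin : PinnedRegions (⟨⟨UnitWitness.unitShells p, D, G⟩, col⟩ : LatticeSituation Checks.toyIndex) P ρ qK) :
    PilotKummerIndRelated (⟨⟨UnitWitness.unitShells p, D, G⟩, col⟩ : LatticeSituation Checks.toyIndex) P ρ qK ↔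
      ∀ (j : Checks.toyIndex.Label) (vQ : Checks.toyIndex.VQ),
        ∃ c : ℚ, UnitWitness.IsPUnit p c ∧ P.qRegion j vQ = (fun x => c • x) '' P.thetaRegion3 j vQ := by
  rw [← reading3_iff_pilotKummerIndRelated (⟨⟨UnitWitness.unitShells p, D, G⟩, col⟩ : LatticeSituation Checks.toyIndex) P ρ qK hKumB hpin]
  refine forall₂_congr fun j vQ => ?_
  rw [possibleImages_eq_unitOrbit p D G P j vQ, Set.mem_setOf_eq]

end UnitShells

/-! ## 3. Split shells: the residual reads the permutation orbit -/

section SplitShells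

variable (D : ℤ → MRData splitShells) (G : ∀ (n : ℤ) (j : splitIndex.LabelStar), GlobalDegrees splitShells j)
  (P : Cor312.Setting (⟨splitShells, D, G⟩ : Situation splitIndex))

/-- **THE RESIDUAL OVER THE SPLIT SHELLS READS THE PERMUTATION ORBIT.** Under Thm. 3.11 (ii) (b) for the column and the two region pins, `S` holds
iff at every packet the q-pilot region is a capsule-permute `permute σ '' A` of the Θ-region — P♮₁: `σ = swapLast` at every label of `𝔽_l^⋇`
(abc-iut-w5-d230 `splitSetting_pilotKummerIndRelated`); P♮ₑ: no `σ` carries the Θ-box onto the shallower q-box (abc-iut-rp-h3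
`excSetting_not_pilotKummerIndRelated`). [claim: Mochizuki2012, status: disputed] -/
theorem residual_iff_splitShells (col : ℤ → Column splitShells)
    (ρ : (∀ v : splitIndex.V, v ∈ splitIndex.Vbad → Set (splitShells.StarPacket v)) →
      ∀ (j : splitIndex.Label) (vQ : splitIndex.VQ), Set (splitShells.Packet j vQ))
    (qK : ∀ v : splitIndex.V, v ∈ splitIndex.Vbad → Set (splitShells.StarPacket v))
    (hKumB : (col P.n).KummerB (D P.n)) (hpin : PinnedRegions (⟨⟨splitShells, D, G⟩, col⟩ : LatticeSituation splitIndex) P ρ qK) :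
    PilotKummerIndRelated (⟨⟨splitShells, D, G⟩, col⟩ : LatticeSituation splitIndex) P ρ qK ↔
      ∀ (j : splitIndex.Label) (vQ : splitIndex.VQ),
        ∃ σ : Equiv.Perm (splitIndex.Caps j), P.qRegion j vQ = splitShells.permute j vQ σ '' P.thetaRegion3 j vQ := by
  rw [← reading3_iff_pilotKummerIndRelated (⟨⟨splitShells, D, G⟩, col⟩ : LatticeSituation splitIndex) P ρ qK hKumB hpin]
  refine forall₂_congr fun j vQ => ?_
  rw [possibleImages_eq_permOrbit_splitShells D G P j vQ, Set.mem_setOf_eq]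

end SplitShells

end Summit.ABC.IUTFork.Cor312Vol.IndTrivial

end
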